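import Literature.Probability.LatticeModels.BesselIDebyeAsymptotics
import HarnessLib

/-!
# The saddle-point interpolation of the modified Bessel coefficients `n ↦ I_n(β)` (FS81 App. B)

Support file of the proof programme of the named fact
`Literature.MathematicalPhysics.QuantumFieldTheory.FrohlichSpencerU1PerimeterLawD4`.
Fröhlich–Spencer 1982 prove the perimeter law for the VILLAIN action and assert (p. 433) that the
Wilson action is handled "by combining the present techniques with an adaptation of Appendix B,
Lemma 4.3 and of the methods in Sect. 6 of [Fröhlich–Spencer 1981] … due to the analytical
subtleties of modified Bessel functions, the details are rather lengthy". Appendix B of FS81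
("An analytic interpolation of `I_β(n)` and estimates on Bessel functions") constructs a function
`I_β(φ)` of a REAL (indeed complex) variable with `I_β(n) = I_n(β) = (2π)⁻¹ ∫_{-π}^{π} e^{β cos θ} e^{inθ} dθ`
at the integers ((B.1)), by steepest descent: "Let `θ_c` be the critical point of
`β cos θ + inθ`, i.e. `θ_c = i sinh⁻¹(n/β) = iτ`. We change variables `θ → θ + iτ` ((B.3)) … Thus we
obtain `I_β(n) = e^{-nτ} (2π)⁻¹ ∫_{-π}^{π} e^{β cos θ cosh τ - iβ sinh τ sin θ + inθ} dθ`" ((B.4)).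
The tree's `BesselIDebyeAsymptotics` proves (B.3)–(B.4) for integer order and every shift `r`
(`besselI_eq_integral_cosh`) and the uniform asymptotics (B.12) at the integers, and leaves the
interpolation itself to a sequel. This file DEFINES the interpolation for real `φ`, taking the
expression (B.4) with `τ = τ(φ) = arsinh(φ/β)` for non-integer `φ`, in real form — with
`β sinh τ = φ` and `β cosh τ = √(β² + φ²) =: B(φ)` the phase of the integrand is `φ(θ - sin θ)`:

  `besselInterp β φ = e^{-φ τ(φ)} (2π)⁻¹ ∫_{-π}^{π} e^{B(φ) cos θ} cos(φ (θ - sin θ)) dθ`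
  `               = exp(F_β(φ)) · amp β φ`,

`F_β(φ) = √(β² + φ²) - φ arsinh(φ/β)` (the saddle exponent, FS81's `ln L_β` up to the prefactor;
`F_β' = -arsinh(·/β)`, `F_β'' = -1/√(β² + φ²) ∈ [-1/β, 0)`, cf. the tree's Yamada–Watanabe function
`ywF β = β - F_β`), `amp β φ = (2π)⁻¹ ∫_{-π}^{π} e^{-B(φ)(1 - cos θ)} cos(φ(θ - sin θ)) dθ` (the
slowly varying amplitude, `≈ (2πB)^{-1/2}`), and PROVES the interpolation property (a) of
FS81 §6: `besselInterp_intCast : besselInterp β n = I_n(β)` for `n ∈ ℤ`, `β > 0` (from the tree's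
`besselI_eq_integral_cosh` at `r = τ(n)`), together with `besselInterp_neg` (evenness),
`besselInterp_eq_integral` (the form (B.4)), and the `bigB`/`saddleR` algebra
(`β cosh τ = B`, `β sinh τ = φ`, `B² = β² + φ²`).

Positivity, the uniform asymptotics `amp ≈ (2πB)^{-1/2}` for REAL `φ` and the translation estimates
(b)–(d) of FS81 §6 are the objects of the sequels. Everything here is proved; no named fact is
introduced.

## References

* J. Fröhlich, T. Spencer, Comm. Math. Phys. 81 (1981) 527–602, Appendix B (B.1)–(B.4), (B.12)–(B.14),
  §6 (properties (a)–(d) of `I_β`, p. 576). [FrohlichSpencerKT1981]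
* J. Fröhlich, T. Spencer, Comm. Math. Phys. 83 (1982) 411–454, p. 433. [FrohlichSpencerCMP1982]
-/

noncomputable section

open MeasureTheory Real Filter intervalIntegral
open scoped Topology

namespace Literature.Probability.LatticeModels

namespace BesselInterp

/-! ### The saddle parameters -/

/-- The saddle `τ(φ) = arsinh(φ/β)` of the phase `β cos θ + iφθ`. [cite: FrohlichSpencerKT1981, App. B (B.2)] -/
def saddleR (β φ : ℝ) : ℝ := Real.arsinh (φ / β)

/-- `B(φ) = √(β² + φ²)` (`= β cosh τ(φ)`), the effective inverse temperature at the saddle.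
[cite: FrohlichSpencerKT1981, App. B (B.4)–(B.6)] -/
def bigB (β φ : ℝ) : ℝ := Real.sqrt (β ^ 2 + φ ^ 2)

/-- `β cosh τ(φ) = B(φ)` for `β > 0`. [folklore] -/
theorem mul_cosh_saddleR {β : ℝ} (hβ : 0 < β) (φ : ℝ) : β * Real.cosh (saddleR β φ) = bigB β φ := by
  rw [saddleR, Real.cosh_arsinh, bigB]
  have h : β ^ 2 + φ ^ 2 = β ^ 2 * (1 + (φ / β) ^ 2) := by field_simp
  rw [h, Real.sqrt_mul (sq_nonneg β), Real.sqrt_sq hβ.le]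

/-- `β sinh τ(φ) = φ` for `β > 0`. [folklore] -/
theorem mul_sinh_saddleR {β : ℝ} (hβ : 0 < β) (φ : ℝ) : β * Real.sinh (saddleR β φ) = φ := by
  rw [saddleR, Real.sinh_arsinh]
  field_simp

/-- `B(φ)² = β² + φ²`. [folklore] -/
theorem bigB_sq (β φ : ℝ) : bigB β φ ^ 2 = β ^ 2 + φ ^ 2 := Real.sq_sqrt (by positivity)

/-- `B(φ) > 0` for `β > 0`. [folklore] -/
theorem bigB_pos {β : ℝ} (hβ : 0 < β) (φ : ℝ) : 0 < bigB β φ := Real.sqrt_pos.2 (by positivity)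

/-- `β ≤ B(φ)`. [folklore] -/
theorem le_bigB {β : ℝ} (hβ : 0 ≤ β) (φ : ℝ) : β ≤ bigB β φ :=
  calc β = Real.sqrt (β ^ 2) := (Real.sqrt_sq hβ).symm
    _ ≤ bigB β φ := Real.sqrt_le_sqrt (by nlinarith [sq_nonneg φ])

/-- `|φ| ≤ B(φ)`. [folklore] -/
theorem abs_le_bigB (β φ : ℝ) : |φ| ≤ bigB β φ :=
  calc |φ| = Real.sqrt (φ ^ 2) := (Real.sqrt_sq_eq_abs φ).symm
    _ ≤ bigB β φ := Real.sqrt_le_sqrt (by nlinarith [sq_nonneg β])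

/-- `B` is even in `φ`. [folklore] -/
theorem bigB_neg (β φ : ℝ) : bigB β (-φ) = bigB β φ := by simp [bigB]

/-- `τ` is odd in `φ`. [folklore] -/
theorem saddleR_neg (β φ : ℝ) : saddleR β (-φ) = -saddleR β φ := by
  simp [saddleR, neg_div, Real.arsinh_neg]

/-! ### The interpolation -/

/-- **The saddle exponent** `F_β(φ) = √(β² + φ²) - φ arsinh(φ/β)` (`= β cosh τ - φ τ` at the saddle;
the tree's Yamada–Watanabe function is `ywF β φ = β - F_β(φ)`). [cite: FrohlichSpencerKT1981, App. B (B.11)–(B.12) (the function L_β)] -/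
def expo (β φ : ℝ) : ℝ := bigB β φ - φ * saddleR β φ

/-- **The amplitude** `amp β φ = (2π)⁻¹ ∫_{-π}^{π} e^{-B(φ)(1 - cos θ)} cos(φ(θ - sin θ)) dθ` of the
saddle-point integral (slowly varying in `φ`, `≈ (2πB(φ))^{-1/2}` for large `β`).
[cite: FrohlichSpencerKT1981, App. B (B.4)–(B.10)] -/
def amp (β φ : ℝ) : ℝ :=
  (2 * π)⁻¹ * ∫ θ in (-π)..π, Real.exp (-(bigB β φ) * (1 - Real.cos θ)) * Real.cos (φ * (θ - Real.sin θ))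

/-- **The saddle-point interpolation of the modified Bessel coefficients** (FS81 App. B):
`besselInterp β φ = exp(F_β(φ)) · amp β φ = e^{-φτ(φ)} (2π)⁻¹ ∫_{-π}^{π} e^{B(φ) cos θ} cos(φ(θ - sin θ)) dθ`.
[cite: FrohlichSpencerKT1981, App. B (B.4), (B.12) (I_β = L_β E_β)] -/
def besselInterp (β φ : ℝ) : ℝ := Real.exp (expo β φ) * amp β φ

/-- The saddle factorisation (definitional). [folklore] -/
theorem besselInterp_eq_exp_mul_amp (β φ : ℝ) : besselInterp β φ = Real.exp (expo β φ) * amp β φ := rfl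

/-- **The contour-shifted form** ((B.4)):
`besselInterp β φ = e^{-φ τ(φ)} (2π)⁻¹ ∫_{-π}^{π} e^{B(φ) cos θ} cos(φ (θ - sin θ)) dθ`.
[cite: FrohlichSpencerKT1981, App. B (B.4)] -/
theorem besselInterp_eq_integral (β φ : ℝ) :
    besselInterp β φ = Real.exp (-(φ * saddleR β φ)) * ((2 * π)⁻¹ *
      ∫ θ in (-π)..π, Real.exp (bigB β φ * Real.cos θ) * Real.cos (φ * (θ - Real.sin θ))) := by
  rw [besselInterp, amp, expo, sub_eq_add_neg, Real.exp_add, mul_comm (Real.exp (bigB β φ)), mul_assoc,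
    mul_left_comm (Real.exp (bigB β φ)), ← intervalIntegral.integral_const_mul (Real.exp (bigB β φ))]
  congr 2
  refine intervalIntegral.integral_congr fun θ _ => ?_
  rw [← mul_assoc, ← Real.exp_add]
  congr 2
  ring

/-- The interpolation is even in `φ`. [cite: FrohlichSpencerKT1981, §6 property (b) (I_β even)] -/
theorem besselInterp_neg (β φ : ℝ) : besselInterp β (-φ) = besselInterp β φ := by
  simp only [besselInterp, expo, amp, bigB_neg, saddleR_neg, neg_mul, mul_neg, neg_neg, Real.cos_neg]

/-- **Property (a): the interpolation agrees with the Bessel coefficients at the integers**,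
`besselInterp β n = I_n(β)` (`β > 0`, `n ∈ ℤ`): the tree's shifted-contour representation
`besselI_eq_integral_cosh` (FS81 (B.3)–(B.4)) at the saddle shift `r = τ(n)`, where `β cosh r = B(n)`
and `β sinh r = n`. [cite: FrohlichSpencerKT1981, §6 property (a), App. B (B.1)–(B.4)] -/
theorem besselInterp_intCast {β : ℝ} (hβ : 0 < β) (n : ℤ) : besselInterp β n = besselI n β := by
  rw [besselInterp_eq_integral, besselI_eq_integral_cosh β (saddleR β n) n, mul_cosh_saddleR hβ,
    mul_sinh_saddleR hβ]
  have hcos : ∀ θ : ℝ, Real.cos ((n : ℝ) * Real.sin θ - n * θ) = Real.cos (n * (θ - Real.sin θ)) :=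
    fun θ => by rw [← Real.cos_neg]; congr 1; ring
  simp_rw [hcos]
  ring

end BesselInterp

end Literature.Probability.LatticeModels
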